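import Literature.Computability.AlgebraicComplexity.MalodGenericComputation
import Literature.Computability.AlgebraicComplexity.IMMInVPProofs
import HarnessLib

/-!
# The unbounded-degree classes `VPnb^F`, `VNPnb^F` over a field and their description as
# specialisations of the universal class (Bürgisser 2024 survey, §4.2)

P. Bürgisser, *Completeness classes in algebraic complexity theory* (arXiv:2406.06217, 2024),
§4.2 (held text `paper:arxiv-2406.06217`, p0016 L8–L11):

> We define the unbounded degree classes `VPnb^𝔽, VNPnb^𝔽` over a field `𝔽` by allowing
> circuits using constants in `𝔽` for free. As for the bounded degree classes, these classes are
> obtained from the universal classes `VPnb⁰, VNPnb⁰` by specializing certain variables to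
> constants in `𝔽`.

Rendering (the convention of `Bur24UnboundedDegreeClasses.lean` / `ConstantFreeValiant.lean`, with
the constant-freeness dropped): a family `f = (f_n)`, `f_n ∈ k[σ_n]`, over a commutative ring
`k` (the survey: a field) is in `VPnb^k` (`IsVPnbFamily f`) iff `#σ_n` is p-bounded and `f_n` is
computed by fan-in-two arithmetic circuits over `k` (arbitrary constants and sum coefficients) of
p-bounded size — equivalently (`isVPnbFamily_iff_isPComputable`) `#σ_n` and the tree's
complexity `L(f_n)` are p-bounded; `VNPnb^k` (`IsVNPnbFamily`) by Boolean sums over `VPnb^k`.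
The second sentence is PROVED in the following sharp form
(**`Bur24_sec4_2_isVPnbFamily_iff_specialisation`**): `f ∈ VPnb^k` iff `#σ_n` is p-bounded and
`f_n = G_{t(n)}(φ_n)` for a p-bounded `t` and substitutions `φ_n` of the variables of Malod's
generic computation `G_{t(n)}` (`MalodGeneric.genericComputation`, the `VPnb⁰`-complete family of
`MalodGenericComputation.lean`) by variables and constants of `k` — "specializing certain
variables [of a universal family] to constants". (`⇒`: the simulation
`MalodGeneric.eval_eq_aeval_spec_genericComputation`; `⇐`: the circuit for `G_N` and the
substitution bound `complexity_aeval_le`.) Hence `(G_n)` is also `VPnb^k`-complete under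
p-projections (`Bur24_sec4_2_genericComputation_VPnbComplete`), and `VNPnb^k` is likewise obtained
from `(G_n)` (`IsVNPnbFamily.exists_specialisation`); finally `VP ⊆ VPnb`, `VNP ⊆ VNPnb` and
**Rem. 4.9** (`Bur24_rem_4_9`: `VNPnb ⊆ VPnb ⟹ VNP ⊆ VP`, the field-independent half of Thm. 4.8).
Two definitions; 0 named facts.

## References

* [Burgisser2024Completeness] P. Bürgisser, arXiv:2406.06217 (2024), §4.2 (p0016 L8–L11), Def. 4.4,
  Thm. 4.8 and Rem. 4.9 (p0017 L30–L46).
-/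

noncomputable section

open MvPolynomial

namespace Literature.Computability.AlgebraicComplexity

universe u v w

section Classes

variable {k : Type u} [CommRing k] {σ : ℕ → Type v} {τ : ℕ → Type w}
  [∀ n, Fintype (σ n)] [∀ n, Fintype (τ n)]

/-- **Bürgisser 2024, §4.2: the class `VPnb^k`** ("allowing circuits using constants in `𝔽` for
free"): `#σ_n` p-bounded and `f_n` computed by fan-in-two circuits over `k` of p-bounded size
(no degree bound, no restriction on constants). [cite: Burgisser2024Completeness, §4.2 (p0016 L8–L9)] -/
def IsVPnbFamily (f : ∀ n, MvPolynomial (σ n) k) : Prop :=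
  IsPBounded (fun n => Fintype.card (σ n)) ∧
    ∃ C : ∀ n, ArithCircuit k (σ n),
      (∀ n, (C n).IsFanInTwo ∧ (C n).Computes (f n)) ∧ IsPBounded fun n => (C n).size

/-- **Bürgisser 2024, §4.2: the class `VNPnb^k`** — Boolean sums `f_n(X) = Σ_{e ∈ {0,1}^{u n}}
g_n(X, e)` of a `VPnb^k` family `g`. [cite: Burgisser2024Completeness, §4.2 (p0016 L8–L9)] -/
def IsVNPnbFamily (f : ∀ n, MvPolynomial (σ n) k) : Prop :=
  ∃ (u : ℕ → ℕ) (g : ∀ n, MvPolynomial (σ n ⊕ Fin (u n)) k),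
    IsVPnbFamily g ∧ ∀ n, f n = boolSum (g n)

/-- `VPnb^k` in terms of the tree's complexity `L`: `#σ_n` and `L(f_n)` p-bounded (`L` is
attained, `ArithCircuit.exists_computes_size_eq_complexity`). [cite: Burgisser2024Completeness, §4.2 (p0016 L8–L9)] -/
theorem isVPnbFamily_iff_isPComputable (f : ∀ n, MvPolynomial (σ n) k) :
    IsVPnbFamily f ↔ IsPBounded (fun n => Fintype.card (σ n)) ∧ IsPComputable f := by
  constructor
  · rintro ⟨hcard, C, hC, hsize⟩
    exact ⟨hcard, hsize.mono fun n => ArithCircuit.complexity_le_size (hC n).1 (hC n).2⟩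
  · rintro ⟨hcard, hL⟩
    choose C hC using fun n => ArithCircuit.exists_computes_size_eq_complexity (f n)
    exact ⟨hcard, C, fun n => ⟨(hC n).1, (hC n).2.1⟩, hL.mono fun n => ((hC n).2.2).le⟩

/-- `VPnb^k` is stable under renamings into p-bounded variable types. [cite: Burgisser2024Completeness, §4.2 (p0016 L8–L9)] -/
theorem IsVPnbFamily.rename {f : ∀ n, MvPolynomial (σ n) k} (hf : IsVPnbFamily f)
    (e : ∀ n, σ n → τ n) (hτ : IsPBounded fun n => Fintype.card (τ n)) :
    IsVPnbFamily fun n => MvPolynomial.rename (e n) (f n) := by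
  obtain ⟨-, C, hC, hsize⟩ := hf
  refine ⟨hτ, fun n => (C n).rename (e n), fun n => ⟨(hC n).1.rename _, (hC n).2.rename _⟩, ?_⟩
  simpa using hsize

/-- `VPnb^k ⊆ VNPnb^k` (empty Boolean sum). [cite: Burgisser2024Completeness, §4.2 (p0016 L8–L9)] -/
theorem IsVPnbFamily.isVNPnbFamily {f : ∀ n, MvPolynomial (σ n) k} (hf : IsVPnbFamily f) :
    IsVNPnbFamily f := by
  refine ⟨fun _ => 0, fun n => MvPolynomial.rename Sum.inl (f n), hf.rename _ ?_, fun n => ?_⟩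
  · exact hf.1.mono fun n => by simp [Fintype.card_sum]
  · simp only [boolSum]
    rw [Fintype.sum_unique, MvPolynomial.aeval_rename]
    simp [Function.comp_def]

/-- `VPnb⁰`-style families over `k`: a constant-free circuit is in particular a circuit, so the
image in `VPnb^k` of the constant-free class is contained in `VPnb^k` — here in the form: the
generic computation `(G_n)` over `k` is in `VPnb^k`. [cite: Burgisser2024Completeness, §4.2 (p0016 L8–L11)] -/
theorem isVPnbFamily_genericComputation (k : Type u) [CommRing k] :
    IsVPnbFamily fun n => MalodGeneric.genericComputation k n := by
  have hsq : IsPBounded fun n => (n + 1) ^ 2 :=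
    IsPBounded.pow_holds (IsPBounded.add_holds IsPBounded.id (IsPBounded.const 1)) 2
  refine ⟨(IsPBounded.mul_holds (IsPBounded.const 15) hsq).mono fun n => ?_,
    fun n => MalodGeneric.circuit k n, fun n =>
      ⟨MalodGeneric.circuit_isFanInTwo k n, MalodGeneric.circuit_computes k n⟩,
    (IsPBounded.mul_holds (IsPBounded.const 9) hsq).mono fun n => ?_⟩
  · simp only [MalodGeneric.Var, Fintype.card_sum, Fintype.card_prod, Fintype.card_fin,
      Fintype.card_bool]
    nlinarith
  · show (MalodGeneric.circuit k n).size ≤ 9 * (n + 1) ^ 2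
    rw [MalodGeneric.circuit_size]
    nlinarith

/-- Substituting variables and constants into `G_N` costs nothing: `L(G_N(φ)) ≤ N (8N+1)`.
[cite: Burgisser2024Completeness, §4.2 (p0016 L8–L11, L50–L51)] -/
theorem complexity_aeval_genericComputation_le {ρ : Type v} (N : ℕ)
    (φ : MalodGeneric.Var N → MvPolynomial ρ k) (hφ : ∀ i, (∃ x, φ i = X x) ∨ ∃ c, φ i = C c) :
    complexity (aeval φ (MalodGeneric.genericComputation k N)) ≤ N * (8 * N + 1) := by
  classical
  refine (complexity_aeval_le _ φ).trans ?_
  have h0 : ∑ i, complexity (φ i) = 0 := Finset.sum_eq_zero fun i _ => by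
    rcases hφ i with ⟨x, hx⟩ | ⟨c, hc⟩
    · rw [hx]; exact complexity_X_holds (k := k) x
    · rw [hc]; exact complexity_C_holds (σ := ρ) c
  rw [h0, add_zero, ← MalodGeneric.circuit_size k N]
  exact ArithCircuit.complexity_le_size (MalodGeneric.circuit_isFanInTwo k N)
    (MalodGeneric.circuit_computes k N)

/-- **Bürgisser 2024, §4.2: "these classes are obtained from the universal classes … by
specializing certain variables to constants in `𝔽`"** — sharp form for `VPnb`: `f ∈ VPnb^k` iff
`#σ_n` is p-bounded and `f_n = G_{t(n)}(φ_n)` for a p-bounded `t` and substitutions `φ_n` of the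
variables of the (universal, `VPnb⁰`-complete) generic computation `G_{t(n)}` by variables of
`σ_n` and constants of `k`. [cite: Burgisser2024Completeness, §4.2 (p0016 L8–L11)] -/
theorem Bur24_sec4_2_isVPnbFamily_iff_specialisation (f : ∀ n, MvPolynomial (σ n) k) :
    IsVPnbFamily f ↔ IsPBounded (fun n => Fintype.card (σ n)) ∧
      ∃ t : ℕ → ℕ, IsPBounded t ∧ ∀ n, ∃ φ : MalodGeneric.Var (t n) → MvPolynomial (σ n) k,
        (∀ i, (∃ x, φ i = X x) ∨ ∃ c, φ i = C c) ∧
          f n = aeval φ (MalodGeneric.genericComputation k (t n)) := by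
  constructor
  · rintro ⟨hcard, C, hC, hsize⟩
    refine ⟨hcard, fun n => Fintype.card (σ n) + 2 * (C n).size + 1,
      IsPBounded.add_holds (IsPBounded.add_holds hcard
        (IsPBounded.mul_holds (IsPBounded.const 2) hsize)) (IsPBounded.const 1), fun n => ?_⟩
    refine ⟨MalodGeneric.spec _ (C n), MalodGeneric.spec_isVarOrConst, ?_⟩
    rw [← (hC n).2]
    exact MalodGeneric.eval_eq_aeval_spec_genericComputation (hC n).1
  · rintro ⟨hcard, t, ht, h⟩
    refine (isVPnbFamily_iff_isPComputable f).2 ⟨hcard, ?_⟩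
    refine (IsPBounded.mul_holds ht (IsPBounded.add_holds (IsPBounded.mul_holds
      (IsPBounded.const 8) ht) (IsPBounded.const 1))).mono fun n => ?_
    obtain ⟨φ, hφ, hf⟩ := h n
    rw [hf]
    exact complexity_aeval_genericComputation_le (t n) φ hφ

/-- **`(G_n)` is `VPnb^k`-complete under p-projections** (membership and: every `VPnb^k` family is
a p-projection of `(G_n)`), over every commutative ring `k`. [cite: Burgisser2024Completeness, §4.2 (p0016 L8–L11, L52–L54)] -/
theorem Bur24_sec4_2_genericComputation_VPnbComplete (k : Type u) [CommRing k] :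
    IsVPnbFamily (fun n => MalodGeneric.genericComputation k n) ∧
      ∀ {σ : ℕ → Type v} [∀ n, Fintype (σ n)] (f : ∀ n, MvPolynomial (σ n) k),
        IsVPnbFamily f → IsPProjection f (fun n => MalodGeneric.genericComputation k n) := by
  refine ⟨isVPnbFamily_genericComputation k, fun {σ} _ f hf => ?_⟩
  obtain ⟨-, t, ht, h⟩ := (Bur24_sec4_2_isVPnbFamily_iff_specialisation f).1 hf
  refine ⟨t, ht, fun n => ?_⟩
  obtain ⟨φ, hφ, hf⟩ := h n
  exact ⟨φ, hφ, hf⟩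

/-- The `VNPnb` half of "obtained … by specializing certain variables to constants": a
`VNPnb^k` family is a Boolean sum of specialisations of `(G_n)`.
[cite: Burgisser2024Completeness, §4.2 (p0016 L8–L11)] -/
theorem IsVNPnbFamily.exists_specialisation {f : ∀ n, MvPolynomial (σ n) k}
    (hf : IsVNPnbFamily f) :
    ∃ (u : ℕ → ℕ) (t : ℕ → ℕ), IsPBounded t ∧ ∀ n,
      ∃ φ : MalodGeneric.Var (t n) → MvPolynomial (σ n ⊕ Fin (u n)) k,
        (∀ i, (∃ x, φ i = X x) ∨ ∃ c, φ i = C c) ∧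
          f n = boolSum (aeval φ (MalodGeneric.genericComputation k (t n))) := by
  obtain ⟨u, g, hg, hfg⟩ := hf
  obtain ⟨-, t, ht, h⟩ := (Bur24_sec4_2_isVPnbFamily_iff_specialisation g).1 hg
  refine ⟨u, t, ht, fun n => ?_⟩
  obtain ⟨φ, hφ, hgn⟩ := h n
  exact ⟨φ, hφ, by rw [hfg n, hgn]⟩

/-- `VP ⊆ VPnb` (a `VP` family has p-bounded complexity and p-bounded number of variables).
[cite: Burgisser2024Completeness, §4.2 (p0016 L8–L17)] -/
theorem IsVPFamily.isVPnbFamily {f : ∀ n, MvPolynomial (σ n) k} (hf : IsVPFamily f) :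
    IsVPnbFamily f :=
  (isVPnbFamily_iff_isPComputable f).2 ⟨hf.1.1, hf.2⟩

/-- `VNP ⊆ VNPnb`. [cite: Burgisser2024Completeness, §4.2 (p0016 L8–L18)] -/
theorem IsVNPFamily.isVNPnbFamily {f : ∀ n, MvPolynomial (σ n) k} (hf : IsVNPFamily f) :
    IsVNPnbFamily f := by
  obtain ⟨-, u, g, hg, hfg⟩ := hf
  exact ⟨u, g, hg.isVPnbFamily, hfg⟩

/-- **Bürgisser 2024, Rem. 4.9 (the implication `VP^𝔽 = VNP^𝔽 ⇐ VPnb^𝔽 = VNPnb^𝔽` of Thm. 4.8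
holds over any field, "by the homogenization trick")** — here over every commutative ring `k`,
with the equalities rendered by their non-trivial inclusions (`VP ⊆ VNP`, `VPnb ⊆ VNPnb` being
unconditional, `IsVPnbFamily.isVNPnbFamily`): if `VNPnb^k ⊆ VPnb^k` then `VNP^k ⊆ VP^k`. Proof as
printed: `f ∈ VNP ⊆ VNPnb`, so `f ∈ VPnb` by the hypothesis, i.e. `L(f_n)` is p-bounded; `f` is a
p-family, hence `f ∈ VP`. (In the tree's rendering `VP` = p-bounded size AND degree — the survey's
Rem. 2.10 (1) form, equivalent to the multiplicatively disjoint form by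
`isVPFamily_iff_exists_isMultiplicativelyDisjoint` — so the homogenization step, Prop. 2.2, is
absorbed in that equivalence.) [cite: Burgisser2024Completeness, Rem. 4.9 (p0017 L43–L46) and Thm. 4.8] -/
theorem Bur24_rem_4_9
    (h : ∀ {σ : ℕ → Type v} [∀ n, Fintype (σ n)] (f : ∀ n, MvPolynomial (σ n) k),
      IsVNPnbFamily f → IsVPnbFamily f)
    {f : ∀ n, MvPolynomial (σ n) k} (hf : IsVNPFamily f) : IsVPFamily f :=
  ⟨hf.1, ((isVPnbFamily_iff_isPComputable f).1 (h f hf.isVNPnbFamily)).2⟩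

end Classes

end Literature.Computability.AlgebraicComplexity

end
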